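import Literature.Barriers.ValiantsHypothesis.GCTMatrixPoweringSemigroup
import Literature.NumberTheory.DiophantineGeometry.SymmetricGroupRepsSignTwist
import HarnessLib

/-!
# Gesmundo–Ikenmeyer–Panova 2017, Thm. 16 PROVED (positivity form): the symmetric or skew
# Kronecker coefficient of a column `(1^D)` against a self-conjugate partition

Sibling proofs file (D-0014; theorems and two model definitions, no named facts) of
`GCTMatrixPowering.lean`, `GCTMatrixPoweringColumns.lean` (named fact `GIP2017_prop17`, columns)
and `GCTMatrixPoweringSemigroup.lean` (the word-model bridge `skPos_iff_exists` /
`akPos_iff_exists`: `sk(λ, μ) > 0`, `ak(λ, μ) > 0` iff a nonzero `𝔖_D`-invariant tensor in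
`HW_λ ⊗ HW_μ ⊗ HW_μ` of switch-parity `+1` / `-1` exists), conventions as there. GIP's Prop. 17
("`sm(1^a, ℓ) > 0` iff `a ∉ X_s`, `am(1^a, ℓ) > 0` iff `a ∉ X_a`"), one of the three remaining named
facts under the barrier `GCTMatrixPowering`, is proved in print from **Thm. 16** and explicit
self-conjugate partitions; this file proves Thm. 16 in its positivity form.

**The printed result** (arXiv:1611.00827 = Diff. Geom. Appl. 55 (2017), §3 p. 10 and §6,
flat numbering of the held text). "For a self-conjugate partition `λ` ... define its sign
`sgn(λ)` to be `1` if the number of boxes above the main diagonal is even, `-1` otherwise.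
Theorem 16. Let `π = (D × 1)` and let `λ ⊢ D` be self conjugate. Then `sk(π, λ) = 1` and
`ak(π, λ) = 0` if `sgn(λ) = 1`, and `sk(π, λ) = 0` and `ak(π, λ) = 1` if `sgn(λ) = -1`." §6 proves it
on the tableau presentation `[λ] = T(λ)/K(λ)`: with `T₁` the standard tableau of the column, `T₂`
the row standard and `T₃` the column standard tableau of `λ`, Lemma 35: `P(T₁ ⊗ T₂ ⊗ T₃) ≠ 0` for
the projection `P = (1/D!) Σ_σ σ` onto the invariants (via `g(π, λ, λ) = 1` and a transport of
tableaux), Prop. 36: `T₁ ⊗ T₂ ⊗ T₃ = sgn(λ) T₁ ⊗ T₃ ⊗ T₂` (the self-inverse permutation `σ`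
reflecting `T₂` onto `T₃` has `sgn(σ) = sgn(λ)`), hence `P(𝒯) ≠ 0` for
`𝒯 = T₁ ⊗ T₂ ⊗ T₃ ± T₁ ⊗ T₃ ⊗ T₂ ∈ [π] ⊗ S²[λ]` resp. `[π] ⊗ Λ²[λ]`.

**What is proved here** (positivity parts; the vanishing parts `ak = 0` resp. `sk = 0`, i.e. the
values `1`/`0`, are not needed for Prop. 17's "if" direction and are not formalised):
`skPos_column_of_sign_eq_one` — for self-conjugate `μ ⊢ D` with `sgn(π_μ) = 1`, `SkPos (1^D) μ`;
`akPos_column_of_sign_eq_neg_one` — with `sgn(π_μ) = -1`, `AkPos (1^D) μ`; and the `sm`/`am`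
forms used by Prop. 17 (`smPos_column_of_sign_eq_one`, `amPos_column_of_sign_eq_neg_one`:
`sm(1^D, ℓ(μ)) > 0` resp. `am(1^D, ℓ(μ)) > 0`). Here `sgn(μ)` is realised as the sign of the
diagonal reflection `π_μ ∈ 𝔖_D` of the row-reading tableau (the tree's
`Nat.Partition.transposePerm`, an involution when `μᵗ = μ`), and `sign_transposePerm_of_self`
computes it as `(-1)^{(D - d(μ))/2}`, `d(μ)` the number of diagonal boxes — GIP's `sgn(λ)`.

**Proof.** In the word model (`KroneckerSemigroup.lean`, `GCTMatrixPoweringSemigroup.lean`), with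
`A` the polytabloid of the row-reading tableau of `(1^D)` (the normalised alternating tensor:
`A(u ∘ τ) = sgn(τ) A(u)`, §2), `e = e_{T₂}` the polytabloid of the row-reading tableau of `μ` and
`e_{T₃} = π · e` (`e_{T₃}(u) = e(u ∘ π)`), GIP's tensor is `M = Σ_τ τ · (A ⊗ e ⊗ π·e)` (`gipTensor`,
§3): it lies in `HW_{(1^D)} ⊗ HW_μ ⊗ HW_μ` and is `𝔖_D`-invariant by construction.
* *Switch-parity* (Prop. 36): switching the two `μ`-factors and reindexing `τ ↦ τ π` gives
  `s M = sgn(π) M`, as `A` is alternating and `π² = 1` (`gipTensor_swap3`).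
* *Nonvanishing* (replacing Lemma 35's transport argument by the Young symmetrizer, all in the
  tree): at the words `(r₁, r, r ∘ π)` (`r₁`, `r` the row-reading words),
  `M = Σ_τ sgn(τ) e(r ∘ τ) e(r ∘ π τ π)`; now `e(r ∘ τ) = (b_μ a_μ)(τ⁻¹) = c_μ(τ)`
  (`orbitMap_apply_comp_inv`, `c = a b`, `b a = ĉ`), and for `μᵗ = μ` the tree's
  `c_{μᵗ} = π θ(b_μ a_μ) π⁻¹` (`youngSymmetrizer_transpose`, `θ` the sign twist) reads
  `c_μ(τ) = sgn(τ) (b_μ a_μ)(π τ π)`, so the `τ`-th term is `c_μ(τ) c_μ(τ⁻¹)` and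
  `M = (c_μ²)(1) = D!/f^μ ≠ 0` (`coeff_sq_youngSymmetrizer_ne_zero`) (`gipTensor_apply_ne_zero`).
* The bridge `skPos_iff_exists` / `akPos_iff_exists` turns `M` into `sk > 0` / `ak > 0` (§4), and
  Mathlib's `Equiv.Perm.sign_of_pow_two_eq_one` computes `sgn(π_μ)` from its fixed points, the
  diagonal entries (§5).

## References

* [GesmundoIkenmeyerPanova2017] F. Gesmundo, C. Ikenmeyer, G. Panova, *Geometric complexity theory
  and matrix powering*, Diff. Geom. Appl. 55 (2017) 106–127 = arXiv:1611.00827: §3 (`sgn(λ)`,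
  Thm. 16, Prop. 17 and its proof), §6 (Thm. 33, Lemma 34, Lemma 35, Prop. 36, proof of Thm. 16).
* [FultonHarrisGTM129] W. Fulton, J. Harris, GTM 129: §4.1 (Young symmetrizers, Ex. 4.4),
  Lemma 4.26 (`c_λ² = n_λ c_λ`).
* [JamesLNM682] G. D. James, LNM 682: 4.3 (polytabloids), 6.6–6.7 (the conjugate partition).

## Tree

`SymmetricGroupRepsSignTwist.lean` (`Nat.Partition.transposePerm`, `rowOf_transposePerm`,
`colOf_transposePerm`, `rowOf_colOf_injective`, `signTwistAlgHom`, `youngSymmetrizer_transpose`,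
`coeff_sq_youngSymmetrizer_ne_zero`, `sign_cast_mul_self`), `SymmetricGroupRepsFinrankSpechtProofs.lean`
(`StdFilling.rowReading`, `rowReadingWord`, `orbitMap_apply_comp_inv`, `orbitMap_colAntisymmetrizer`,
`grpAlgFlip_youngSymmetrizer`, `coeff_grpAlgFlip`, `StdFilling.mem_colStab_rowReading`),
`SchurWeylPlethysmHwMultiplicityProofs.lean` (`StdFilling.polytabloid`, `polytabloid_mem`,
`polytabloid_apply_rowWord`, `ydWeight_youngDiagram`), `PlethysmStability.lean`
(`StdFilling.wordPerm_polytabloid_of_mem_colStab`), `GCTMatrixPoweringColumns.lean`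
(`sortedParts_column`), `SchurFunctor.lean` (`Nat.Partition.column`). Mathlib:
`Equiv.Perm.sign_of_pow_two_eq_one`, `MonoidAlgebra.coeff_mul_apply_left`.
-/

noncomputable section

open scoped BigOperators

namespace Literature.Barriers.ValiantsHypothesis

open Literature.NumberTheory.DiophantineGeometry Literature.Computability.Complexity

/-! ### 1. Self-conjugate partitions: the transpose involution `π_μ` of the row-reading tableau -/

section SelfConjugate

variable {D : ℕ} {μ : Nat.Partition D}

/-- For self-conjugate `μ`, `π_μ i` lies in row `col_μ(i)`. [folklore] -/
theorem rowOf_transposePerm_of_self (h : μ.transpose = μ) (i : Fin D) :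
    μ.rowOf (μ.transposePerm i) = μ.colOf i := by
  have := μ.rowOf_transposePerm i
  rwa [h] at this

/-- For self-conjugate `μ`, `π_μ i` lies in column `row_μ(i)`. [folklore] -/
theorem colOf_transposePerm_of_self (h : μ.transpose = μ) (i : Fin D) :
    μ.colOf (μ.transposePerm i) = μ.rowOf i := by
  have := μ.colOf_transposePerm i
  rwa [h] at this

/-- For self-conjugate `μ`, `π_μ` is an involution (it reflects the row-reading tableau in the
diagonal; GIP Prop. 36: "There exists a self inverse permutation `σ ∈ 𝔖_D` with `σ(T₂) = T₃` and
`σ(T₃) = T₂`"). [cite: GesmundoIkenmeyerPanova2017, Prop. 36 (proof)] -/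
theorem transposePerm_transposePerm (h : μ.transpose = μ) (i : Fin D) :
    μ.transposePerm (μ.transposePerm i) = i :=
  μ.rowOf_colOf_injective (by
    simp only [rowOf_transposePerm_of_self h, colOf_transposePerm_of_self h])

/-- `π_μ² = 1` for self-conjugate `μ`. [cite: GesmundoIkenmeyerPanova2017, Prop. 36 (proof)] -/
theorem transposePerm_mul_self (h : μ.transpose = μ) : μ.transposePerm * μ.transposePerm = 1 :=
  Equiv.ext fun i => by
    rw [Equiv.Perm.mul_apply, Equiv.Perm.one_apply]
    exact transposePerm_transposePerm h i

/-- `π_μ⁻¹ = π_μ` for self-conjugate `μ`. [folklore] -/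
theorem transposePerm_inv (h : μ.transpose = μ) : μ.transposePerm⁻¹ = μ.transposePerm :=
  inv_eq_of_mul_eq_one_right (transposePerm_mul_self h)

/-- `sgn(π σ π) = sgn(σ)`. [folklore] -/
theorem sign_conj_transposePerm (σ : Equiv.Perm (Fin D)) :
    Equiv.Perm.sign (μ.transposePerm * σ * μ.transposePerm) = Equiv.Perm.sign σ := by
  rw [Equiv.Perm.sign_mul, Equiv.Perm.sign_mul, mul_comm, ← mul_assoc, Int.units_mul_self, one_mul]

variable (k : Type*) [Field k]

/-- Coefficients of the sign twist: `θ(x)(g) = sgn(g) x(g)`. [folklore] -/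
theorem coeff_signTwistAlgHom (x : MonoidAlgebra k (Equiv.Perm (Fin D))) (g : Equiv.Perm (Fin D)) :
    (signTwistAlgHom k D x).coeff g = ((Equiv.Perm.sign g : ℤ) : k) * x.coeff g := by
  induction x using MonoidAlgebra.induction_on with
  | hM σ =>
    rw [MonoidAlgebra.of_apply, signTwistAlgHom_single, MonoidAlgebra.coeff_single,
      MonoidAlgebra.coeff_single, Finsupp.single_apply, Finsupp.single_apply]
    by_cases hσ : σ = g
    · subst hσ; rw [if_pos rfl, if_pos rfl]
    · rw [if_neg hσ, if_neg hσ, mul_zero]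
  | hadd x y hx hy =>
    rw [map_add, MonoidAlgebra.coeff_add, Finsupp.add_apply, hx, hy, MonoidAlgebra.coeff_add,
      Finsupp.add_apply, mul_add]
  | hsmul r x hx =>
    rw [map_smul, MonoidAlgebra.coeff_smul, Finsupp.smul_apply, hx, MonoidAlgebra.coeff_smul,
      Finsupp.smul_apply, smul_eq_mul, smul_eq_mul, mul_left_comm]

/-- **`c_μ = π θ(b_μ a_μ) π` for self-conjugate `μ`** (the tree's `c_{μᵗ} = π θ(b_μ a_μ) π⁻¹`,
`youngSymmetrizer_transpose`, with `μᵗ = μ`, `π⁻¹ = π`). [folklore] -/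
theorem youngSymmetrizer_eq_conj_of_self (h : μ.transpose = μ) :
    youngSymmetrizer k μ = MonoidAlgebra.of k _ μ.transposePerm *
      signTwistAlgHom k D (colAntisymmetrizer k μ * rowSymmetrizer k μ) *
        MonoidAlgebra.of k _ μ.transposePerm := by
  have := youngSymmetrizer_transpose k μ
  rwa [h, transposePerm_inv h] at this

/-- **The coefficients of `c_μ` against those of `b_μ a_μ`** for self-conjugate `μ`:
`c_μ(τ) = sgn(τ) (b_μ a_μ)(π τ π)`. [folklore] -/
theorem coeff_youngSymmetrizer_of_self (h : μ.transpose = μ) (τ : Equiv.Perm (Fin D)) :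
    (youngSymmetrizer k μ).coeff τ = ((Equiv.Perm.sign τ : ℤ) : k) *
      (colAntisymmetrizer k μ * rowSymmetrizer k μ).coeff
        (μ.transposePerm * τ * μ.transposePerm) := by
  rw [youngSymmetrizer_eq_conj_of_self k h, MonoidAlgebra.of_apply, mul_assoc,
    MonoidAlgebra.coeff_single_mul_apply, one_mul, MonoidAlgebra.coeff_mul_single_apply, mul_one,
    coeff_signTwistAlgHom, transposePerm_inv h, sign_conj_transposePerm]

/-- `(b_μ a_μ)(τ) = c_μ(τ⁻¹)` (`b a` is the flip `ĉ` of `c = a b`). [folklore] -/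
theorem coeff_colAntisymmetrizer_mul_rowSymmetrizer (τ : Equiv.Perm (Fin D)) :
    (colAntisymmetrizer k μ * rowSymmetrizer k μ).coeff τ = (youngSymmetrizer k μ).coeff τ⁻¹ := by
  rw [← grpAlgFlip_youngSymmetrizer, coeff_grpAlgFlip]

/-- `(c_μ²)(1) = Σ_τ c_μ(τ) c_μ(τ⁻¹)`. [folklore] -/
theorem coeff_sq_youngSymmetrizer_eq_sum :
    (youngSymmetrizer k μ * youngSymmetrizer k μ).coeff 1 =
      ∑ τ : Equiv.Perm (Fin D), (youngSymmetrizer k μ).coeff τ * (youngSymmetrizer k μ).coeff τ⁻¹ := by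
  rw [MonoidAlgebra.coeff_mul_apply_left, Finsupp.sum_fintype]
  · simp only [mul_one]
  · intro τ; rw [zero_mul]

end SelfConjugate

/-! ### 2. The column `(1^D)`: its polytabloid is the normalised alternating tensor -/

section Column

variable {D N : ℕ}

/-- The row-reading tableau of the column `(1^D)` has all its entries in column `0`. [folklore] -/
theorem colOf_column (i : Fin D) : (Nat.Partition.column D).colOf i = 0 := by
  have h := (Nat.Partition.column D).rowOf_colOf_mem_youngDiagram i
  rw [YoungDiagram.mem_iff_lt_rowLen, rowLen_youngDiagram, sortedParts_column,
    List.getD_eq_getElem?_getD, List.getElem?_replicate] at h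
  split_ifs at h with hlt
  · simpa using h
  · simp at h

/-- The column stabiliser of `(1^D)` is everything. [folklore] -/
theorem mem_colStabilizer_column (σ : Equiv.Perm (Fin D)) : σ ∈ colStabilizer (Nat.Partition.column D) :=
  (mem_colStabilizer_iff _ σ).mpr fun i => by rw [colOf_column, colOf_column]

/-- The column `(1^D)` has `D` parts. [folklore] -/
theorem card_parts_column (D : ℕ) : (Nat.Partition.column D).parts.card = D := by
  rw [Nat.Partition.column_parts, Multiset.card_replicate]

variable (k : Type*) [Field k]

/-- **The polytabloid of the column is alternating**: `A(u ∘ τ) = sgn(τ) A(u)` for EVERY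
`τ ∈ 𝔖_D` (the column stabiliser is all of `𝔖_D`; `τ · e_T = sgn(τ) e_T`). [folklore] -/
theorem polytabloid_column_comp (hN : ∀ x ∈ (Nat.Partition.column D).youngDiagram.cells, x.1 < N)
    (u : Word N D) (τ : Equiv.Perm (Fin D)) :
    (StdFilling.rowReading (Nat.Partition.column D)).polytabloid k hN (u ∘ ⇑τ) =
      ((Equiv.Perm.sign τ : ℤ) : k) *
        (StdFilling.rowReading (Nat.Partition.column D)).polytabloid k hN u := by
  have h := (StdFilling.rowReading (Nat.Partition.column D)).wordPerm_polytabloid_of_mem_colStab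
    (k := k) hN ((StdFilling.mem_colStab_rowReading _ τ).mpr (mem_colStabilizer_column τ))
  have := congrFun h u
  rwa [wordPerm_apply, Pi.smul_apply, smul_eq_mul] at this

/-- `A(r₁ ∘ τ) = sgn(τ)` at the row-reading word `r₁` of the column. [folklore] -/
theorem polytabloid_column_rowReadingWord_comp
    (hN : ∀ x ∈ (Nat.Partition.column D).youngDiagram.cells, x.1 < N) (τ : Equiv.Perm (Fin D)) :
    (StdFilling.rowReading (Nat.Partition.column D)).polytabloid k hN
        (rowReadingWord (Nat.Partition.column D) hN ∘ ⇑τ) = ((Equiv.Perm.sign τ : ℤ) : k) := by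
  rw [polytabloid_column_comp, rowReadingWord_eq, StdFilling.polytabloid_apply_rowWord, mul_one]

end Column

/-! ### 3. GIP's tensor `∑_τ τ · (A ⊗ e_{T₂} ⊗ e_{T₃})`: invariance, switch-parity, nonvanishing -/

section Tensor

variable {D N : ℕ} (μ : Nat.Partition D)

/-- For self-conjugate `μ`: `(b_μ a_μ)(π τ π) = sgn(τ) c_μ(τ)`. [folklore] -/
theorem coeff_colAntisymmetrizer_mul_rowSymmetrizer_conj (k : Type*) [Field k]
    (h : μ.transpose = μ) (τ : Equiv.Perm (Fin D)) :
    (colAntisymmetrizer k μ * rowSymmetrizer k μ).coeff (μ.transposePerm * τ * μ.transposePerm) =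
      ((Equiv.Perm.sign τ : ℤ) : k) * (youngSymmetrizer k μ).coeff τ := by
  rw [coeff_youngSymmetrizer_of_self k h τ, ← mul_assoc, sign_cast_mul_self, one_mul]

/-- **The pure tensor `A ⊗ e_{T₂} ⊗ e_{T₃}`** of GIP §6 in the word model: `A` the polytabloid of
the column `(1^D)` (GIP's `T₁`, "the standard tableau of shape `D × 1`"), `e_{T₂}` the polytabloid
of the row-reading ("row standard") tableau of `μ`, and `e_{T₃} = π · e_{T₂}`, `e_{T₃}(u) =
e_{T₂}(u ∘ π)`, the polytabloid of the reflected ("column standard") tableau, `π = π_μ` the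
reflection of the row-reading tableau in the diagonal (`Nat.Partition.transposePerm`).
[cite: GesmundoIkenmeyerPanova2017, §6 (Lemma 35: T₁ standard, T₂ row standard, T₃ column standard)] -/
def gipPure (hN₁ : ∀ x ∈ (Nat.Partition.column D).youngDiagram.cells, x.1 < N)
    (hN : ∀ x ∈ μ.youngDiagram.cells, x.1 < N) : Word3 N D → ℂ := fun t =>
  (StdFilling.rowReading (Nat.Partition.column D)).polytabloid ℂ hN₁ t.1.1 *
    (StdFilling.rowReading μ).polytabloid ℂ hN t.1.2 *
      (StdFilling.rowReading μ).polytabloid ℂ hN (t.2 ∘ ⇑μ.transposePerm)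

/-- **GIP's invariant `P(T₁ ⊗ T₂ ⊗ T₃) = (1/D!) Σ_{σ ∈ 𝔖_D} σ(T₁ ⊗ T₂ ⊗ T₃)`** (without the
factor `1/D!`): the symmetrisation of the pure tensor under the diagonal position action.
[cite: GesmundoIkenmeyerPanova2017, §6 (the projection P, Lemma 34)] -/
def gipTensor (hN₁ : ∀ x ∈ (Nat.Partition.column D).youngDiagram.cells, x.1 < N)
    (hN : ∀ x ∈ μ.youngDiagram.cells, x.1 < N) : Word3 N D → ℂ :=
  sym3 (gipPure μ hN₁ hN)

/-- The pure tensor lies in `HW_{(1^D)} ⊗ HW_μ ⊗ HW_μ` (polytabloids are highest-weight vectors,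
and so is `π · e_{T₂}`). [folklore] -/
theorem gipPure_mem (hN₁ : ∀ x ∈ (Nat.Partition.column D).youngDiagram.cells, x.1 < N)
    (hN : ∀ x ∈ μ.youngDiagram.cells, x.1 < N) :
    gipPure μ hN₁ hN ∈ tripleHw ℂ N D (Weight.ofPartition N (Nat.Partition.column D))
      (Weight.ofPartition N μ) (Weight.ofPartition N μ) := by
  have hA : (StdFilling.rowReading (Nat.Partition.column D)).polytabloid ℂ hN₁ ∈
      highestWeightSpace (wordRep ℂ N D) (Weight.ofPartition N (Nat.Partition.column D)) := by
    have := (StdFilling.rowReading (Nat.Partition.column D)).polytabloid_mem (k := ℂ) hN₁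
      (Nat.Partition.column D).card_cells_youngDiagram
    rwa [ydWeight_youngDiagram] at this
  have he : (StdFilling.rowReading μ).polytabloid ℂ hN ∈
      highestWeightSpace (wordRep ℂ N D) (Weight.ofPartition N μ) := by
    have := (StdFilling.rowReading μ).polytabloid_mem (k := ℂ) hN μ.card_cells_youngDiagram
    rwa [ydWeight_youngDiagram] at this
  have he' := wordPerm_mem_highestWeightSpace μ.transposePerm he
  rw [mem_tripleHw_iff]
  refine ⟨fun w₂ w₃ => ?_, fun w₁ w₃ => ?_, fun w₁ w₂ => ?_⟩
  · have : (fun w₁ => gipPure μ hN₁ hN ((w₁, w₂), w₃)) =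
        ((StdFilling.rowReading μ).polytabloid ℂ hN w₂ *
          (StdFilling.rowReading μ).polytabloid ℂ hN (w₃ ∘ ⇑μ.transposePerm)) •
          (StdFilling.rowReading (Nat.Partition.column D)).polytabloid ℂ hN₁ := by
      funext w₁; simp only [gipPure, Pi.smul_apply, smul_eq_mul]; try ring
    rw [this]
    exact Submodule.smul_mem _ _ hA
  · have : (fun w₂ => gipPure μ hN₁ hN ((w₁, w₂), w₃)) =
        ((StdFilling.rowReading (Nat.Partition.column D)).polytabloid ℂ hN₁ w₁ *
          (StdFilling.rowReading μ).polytabloid ℂ hN (w₃ ∘ ⇑μ.transposePerm)) •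
          (StdFilling.rowReading μ).polytabloid ℂ hN := by
      funext w₂; simp only [gipPure, Pi.smul_apply, smul_eq_mul]; try ring
    rw [this]
    exact Submodule.smul_mem _ _ he
  · have : (fun w₃ => gipPure μ hN₁ hN ((w₁, w₂), w₃)) =
        ((StdFilling.rowReading (Nat.Partition.column D)).polytabloid ℂ hN₁ w₁ *
          (StdFilling.rowReading μ).polytabloid ℂ hN w₂) •
          wordPerm ℂ μ.transposePerm ((StdFilling.rowReading μ).polytabloid ℂ hN) := by
      funext w₃; simp only [gipPure, Pi.smul_apply, smul_eq_mul, wordPerm_apply]; try ring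
    rw [this]
    exact Submodule.smul_mem _ _ he'

/-- **Switch-parity `sgn(μ)`** (GIP Prop. 36: "`T₁ ⊗ T₂ ⊗ T₃ = sgn(λ) T₁ ⊗ T₃ ⊗ T₂`"): for
self-conjugate `μ`, switching the two `μ`-factors multiplies the symmetrised tensor by `sgn(π_μ)`
(reindex the symmetrisation by `τ ↦ τ π`; `A` is alternating and `π² = 1`).
[cite: GesmundoIkenmeyerPanova2017, Prop. 36] -/
theorem gipTensor_swap3 (hself : μ.transpose = μ)
    (hN₁ : ∀ x ∈ (Nat.Partition.column D).youngDiagram.cells, x.1 < N)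
    (hN : ∀ x ∈ μ.youngDiagram.cells, x.1 < N) (t : Word3 N D) :
    gipTensor μ hN₁ hN (swap3 t) =
      ((Equiv.Perm.sign μ.transposePerm : ℤ) : ℂ) * gipTensor μ hN₁ hN t := by
  obtain ⟨⟨w₁, w₂⟩, w₃⟩ := t
  simp only [gipTensor, sym3, Finset.mul_sum]
  symm
  refine Fintype.sum_equiv (Equiv.mulRight μ.transposePerm) _ _ fun τ => ?_
  simp only [Equiv.coe_mulRight, gipPure, permute3, swap3, Equiv.Perm.coe_mul]
  have h3 : (w₂ ∘ (⇑τ ∘ ⇑μ.transposePerm)) ∘ ⇑μ.transposePerm = w₂ ∘ ⇑τ := by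
    funext x
    simp only [Function.comp_apply, transposePerm_transposePerm hself]
  rw [h3, show w₁ ∘ (⇑τ ∘ ⇑μ.transposePerm) = (w₁ ∘ ⇑τ) ∘ ⇑μ.transposePerm from rfl,
    show w₃ ∘ (⇑τ ∘ ⇑μ.transposePerm) = (w₃ ∘ ⇑τ) ∘ ⇑μ.transposePerm from rfl,
    polytabloid_column_comp ℂ hN₁ (w₁ ∘ ⇑τ) μ.transposePerm]
  ring

/-- **Nonvanishing** (the content of GIP Lemma 35, "`P(T₁ ⊗ T₂ ⊗ T₃) ≠ 0`", obtained here from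
the Young symmetrizer instead of GIP's transport argument): at the triple of words
`(r₁, r, r ∘ π)` (`r₁`, `r` the row-reading words of `(1^D)` and `μ`) the symmetrised tensor equals
`Σ_τ sgn(τ) e(r∘τ) e(r∘πτπ) = Σ_τ c_μ(τ) c_μ(τ⁻¹) = (c_μ²)(1) = D!/f^μ ≠ 0`, because
`e_{T₂}(r ∘ τ) = (b_μ a_μ)(τ⁻¹) = c_μ(τ)` (`orbitMap_apply_comp_inv`) and, for self-conjugate `μ`,
`c_μ = π θ(b_μ a_μ) π` (`youngSymmetrizer_transpose`), `c_μ² = (D!/f^μ) c_μ`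
(`coeff_sq_youngSymmetrizer_ne_zero`). [cite: GesmundoIkenmeyerPanova2017, Lemma 35] -/
theorem gipTensor_apply_ne_zero (hself : μ.transpose = μ)
    (hN₁ : ∀ x ∈ (Nat.Partition.column D).youngDiagram.cells, x.1 < N)
    (hN : ∀ x ∈ μ.youngDiagram.cells, x.1 < N) :
    gipTensor μ hN₁ hN ((rowReadingWord (Nat.Partition.column D) hN₁, rowReadingWord μ hN),
      rowReadingWord μ hN ∘ ⇑μ.transposePerm) ≠ 0 := by
  have key : gipTensor μ hN₁ hN ((rowReadingWord (Nat.Partition.column D) hN₁, rowReadingWord μ hN),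
      rowReadingWord μ hN ∘ ⇑μ.transposePerm) =
        (youngSymmetrizer ℂ μ * youngSymmetrizer ℂ μ).coeff 1 := by
    simp only [gipTensor, sym3, gipPure, permute3]
    rw [coeff_sq_youngSymmetrizer_eq_sum]
    refine Finset.sum_congr rfl fun τ _ => ?_
    have h2 : (StdFilling.rowReading μ).polytabloid ℂ hN (rowReadingWord μ hN ∘ ⇑τ) =
        (youngSymmetrizer ℂ μ).coeff τ := by
      have := orbitMap_apply_comp_inv ℂ μ hN (colAntisymmetrizer ℂ μ) τ⁻¹
      rw [inv_inv, orbitMap_colAntisymmetrizer] at this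
      rw [this, coeff_colAntisymmetrizer_mul_rowSymmetrizer, inv_inv]
    have h3 : (StdFilling.rowReading μ).polytabloid ℂ hN
        (((rowReadingWord μ hN ∘ ⇑μ.transposePerm) ∘ ⇑τ) ∘ ⇑μ.transposePerm) =
        ((Equiv.Perm.sign τ : ℤ) : ℂ) * (youngSymmetrizer ℂ μ).coeff τ⁻¹ := by
      have e1 : ((rowReadingWord μ hN ∘ ⇑μ.transposePerm) ∘ ⇑τ) ∘ ⇑μ.transposePerm =
          rowReadingWord μ hN ∘ ⇑(μ.transposePerm * τ * μ.transposePerm) := by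
        rw [Equiv.Perm.coe_mul, Equiv.Perm.coe_mul]; rfl
      have e2 : (μ.transposePerm * τ * μ.transposePerm)⁻¹ = μ.transposePerm * τ⁻¹ * μ.transposePerm := by
        rw [mul_inv_rev, mul_inv_rev, transposePerm_inv hself, mul_assoc]
      have := orbitMap_apply_comp_inv ℂ μ hN (colAntisymmetrizer ℂ μ)
        (μ.transposePerm * τ * μ.transposePerm)⁻¹
      rw [inv_inv, orbitMap_colAntisymmetrizer] at this
      rw [e1, this, e2, coeff_colAntisymmetrizer_mul_rowSymmetrizer_conj μ ℂ hself τ⁻¹,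
        Equiv.Perm.sign_inv]
    rw [polytabloid_column_rowReadingWord_comp, h2, h3]
    calc ((Equiv.Perm.sign τ : ℤ) : ℂ) * (youngSymmetrizer ℂ μ).coeff τ *
          (((Equiv.Perm.sign τ : ℤ) : ℂ) * (youngSymmetrizer ℂ μ).coeff τ⁻¹)
        = ((Equiv.Perm.sign τ : ℤ) : ℂ) * ((Equiv.Perm.sign τ : ℤ) : ℂ) *
          ((youngSymmetrizer ℂ μ).coeff τ * (youngSymmetrizer ℂ μ).coeff τ⁻¹) := by ring
      _ = (youngSymmetrizer ℂ μ).coeff τ * (youngSymmetrizer ℂ μ).coeff τ⁻¹ := by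
          rw [sign_cast_mul_self, one_mul]
  rw [key]
  exact coeff_sq_youngSymmetrizer_ne_zero ℂ μ

end Tensor

/-! ### 4. GIP Thm. 16: `sk(1^D, μ) > 0` or `ak(1^D, μ) > 0` according to `sgn(μ) = sgn(π_μ)` -/

section Thm16

variable {D : ℕ} (μ : Nat.Partition D)

/-- **The invariant tensor of GIP §6, packaged**: for self-conjugate `μ ⊢ D` and `N` bounding `D`
and the number of parts of `μ`, a nonzero `𝔖_D`-invariant tensor in `HW_{(1^D)} ⊗ HW_μ ⊗ HW_μ` of
switch-parity `sgn(π_μ)`. [cite: GesmundoIkenmeyerPanova2017, Thm. 16 (proof, §6)] -/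
theorem exists_gipTensor (hself : μ.transpose = μ) {N : ℕ} (hμN : μ.parts.card ≤ N) (hDN : D ≤ N) :
    ∃ M : Word3 N D → ℂ, M ∈ tripleHw ℂ N D (Weight.ofPartition N (Nat.Partition.column D))
      (Weight.ofPartition N μ) (Weight.ofPartition N μ) ∧ M ≠ 0 ∧
        (∀ τ t, M (permute3 τ t) = M t) ∧
          ∀ t, M (swap3 t) = ((Equiv.Perm.sign μ.transposePerm : ℤ) : ℂ) * M t := by
  have hN₁ : ∀ x ∈ (Nat.Partition.column D).youngDiagram.cells, x.1 < N :=
    forall_fst_lt_of_card_le (Nat.Partition.column D) ((card_parts_column D).le.trans hDN)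
  have hN : ∀ x ∈ μ.youngDiagram.cells, x.1 < N := forall_fst_lt_of_card_le μ hμN
  refine ⟨gipTensor μ hN₁ hN, sym3_mem_tripleHw (gipPure_mem μ hN₁ hN), fun h0 => ?_,
    fun τ t => sym3_permute3 _ τ t, gipTensor_swap3 μ hself hN₁ hN⟩
  exact gipTensor_apply_ne_zero μ hself hN₁ hN (by rw [h0]; rfl)

/-- **GIP Thm. 16, symmetric case**: "Let `π = (D × 1)` and let `λ ⊢ D` be self conjugate. Then
`sk(π, λ) = 1` and `ak(π, λ) = 0` if `sgn(λ) = 1`" — positivity part: if `sgn(π_μ) = 1` then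
`sk(1^D, μ) > 0`, rendered `SkPos (1^D) μ`. Here `sgn(μ)` is realised as the sign of the diagonal
reflection `π_μ` of the row-reading tableau ("`sgn(σ) = sgn(λ)`", Prop. 36; it is `(-1)` to the
number of boxes above the diagonal, `sign_transposePerm_eq`). [cite: GesmundoIkenmeyerPanova2017, Thm. 16] -/
theorem skPos_column_of_sign_eq_one (hself : μ.transpose = μ)
    (hsign : Equiv.Perm.sign μ.transposePerm = 1) : SkPos (Nat.Partition.column D) μ := by
  rw [skPos_iff_exists (Nat.Partition.column D) μ (N := max D μ.parts.card)
    ((card_parts_column D).le.trans (le_max_left _ _)) (le_max_right _ _)]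
  obtain ⟨M, hM, hM0, hMi, hMs⟩ := exists_gipTensor μ hself (le_max_right _ _) (le_max_left _ _)
  exact ⟨M, hM, hM0, hMi, fun t => by rw [hMs t, hsign, Units.val_one, Int.cast_one, one_mul]⟩

/-- **GIP Thm. 16, skew case**: "and `sk(π, λ) = 0` and `ak(π, λ) = 1` if `sgn(λ) = -1`" —
positivity part: if `sgn(π_μ) = -1` then `ak(1^D, μ) > 0`, rendered `AkPos (1^D) μ`.
[cite: GesmundoIkenmeyerPanova2017, Thm. 16] -/
theorem akPos_column_of_sign_eq_neg_one (hself : μ.transpose = μ)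
    (hsign : Equiv.Perm.sign μ.transposePerm = -1) : AkPos (Nat.Partition.column D) μ := by
  rw [akPos_iff_exists (Nat.Partition.column D) μ (N := max D μ.parts.card)
    ((card_parts_column D).le.trans (le_max_left _ _)) (le_max_right _ _)]
  obtain ⟨M, hM, hM0, hMi, hMs⟩ := exists_gipTensor μ hself (le_max_right _ _) (le_max_left _ _)
  exact ⟨M, hM, hM0, hMi, fun t => by
    rw [hMs t, hsign, Units.val_neg, Units.val_one, Int.cast_neg, Int.cast_one, neg_one_mul]⟩

/-- **Columns against self-conjugate partitions, `sm` form** (the use of Thm. 16 in Prop. 17: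
"`1 = sk(1^a, μ) ≤ sm(1^a, ℓ(μ))`"): for self-conjugate `μ ⊢ D` with `sgn(π_μ) = 1`,
`sm(1^D, ℓ(μ)) > 0`. [cite: GesmundoIkenmeyerPanova2017, Prop. 17 (proof)] -/
theorem smPos_column_of_sign_eq_one (hself : μ.transpose = μ)
    (hsign : Equiv.Perm.sign μ.transposePerm = 1) : SmPos μ.parts.card (Nat.Partition.column D) :=
  ⟨μ, le_rfl, skPos_column_of_sign_eq_one μ hself hsign⟩

/-- **Columns against self-conjugate partitions, `am` form**: for self-conjugate `μ ⊢ D` with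
`sgn(π_μ) = -1`, `am(1^D, ℓ(μ)) > 0` ("`1 = ak(1^a, ν) ≤ … ≤ am(1^a, ℓ)`").
[cite: GesmundoIkenmeyerPanova2017, Prop. 17 (proof)] -/
theorem amPos_column_of_sign_eq_neg_one (hself : μ.transpose = μ)
    (hsign : Equiv.Perm.sign μ.transposePerm = -1) : AmPos μ.parts.card (Nat.Partition.column D) :=
  ⟨μ, le_rfl, akPos_column_of_sign_eq_neg_one μ hself hsign⟩

end Thm16

/-! ### 5. `sgn(μ)`: the sign of the diagonal reflection `π_μ` -/

section Sign

variable {D : ℕ} (μ : Nat.Partition D)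

/-- The fixed points of `π_μ` (self-conjugate `μ`) are the entries on the diagonal of the
row-reading tableau. [cite: GesmundoIkenmeyerPanova2017, Prop. 36 (proof: "σ consists of disjoint transpositions switching boxes above the main diagonal with the corresponding box at the transpose position")] -/
theorem transposePerm_apply_eq_self_iff (hself : μ.transpose = μ) (i : Fin D) :
    μ.transposePerm i = i ↔ μ.rowOf i = μ.colOf i := by
  constructor
  · intro h
    rw [← rowOf_transposePerm_of_self hself i, h]
  · intro h
    exact μ.rowOf_colOf_injective (by
      simp only [rowOf_transposePerm_of_self hself, colOf_transposePerm_of_self hself, h])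

/-- **`sgn(μ) = (-1)^{(D - d(μ))/2}`**: for self-conjugate `μ ⊢ D` with `d(μ)` diagonal boxes
(the Durfee size; `(D - d(μ))/2` is the number of boxes above the diagonal), the sign of the
diagonal reflection `π_μ` is `(-1)^{(D - d(μ))/2}` — GIP's `sgn(λ)` ("define its sign `sgn(λ)` to be
`1` if the number of boxes above the main diagonal is even, `-1` otherwise"; Prop. 36:
`sgn(σ) = sgn(λ)`). Mathlib's `Equiv.Perm.sign_of_pow_two_eq_one` for the involution `π_μ`.
[cite: GesmundoIkenmeyerPanova2017, §3 (definition of sgn(λ) before Thm. 16) and Prop. 36] -/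
theorem sign_transposePerm_of_self (hself : μ.transpose = μ) :
    Equiv.Perm.sign μ.transposePerm =
      (-1) ^ ((D - (Finset.univ.filter fun i : Fin D => μ.rowOf i = μ.colOf i).card) / 2) := by
  have hsq : μ.transposePerm ^ 2 = 1 := by rw [sq]; exact transposePerm_mul_self hself
  have hcard : Fintype.card (Function.fixedPoints μ.transposePerm) =
      (Finset.univ.filter fun i : Fin D => μ.rowOf i = μ.colOf i).card :=
    Fintype.card_of_subtype _ fun i => by
      rw [Finset.mem_filter, Function.mem_fixedPoints, Function.IsFixedPt,
        transposePerm_apply_eq_self_iff μ hself]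
      simp
  rw [Equiv.Perm.sign_of_pow_two_eq_one hsq, Fintype.card_fin, hcard]
  rfl

end Sign

end Literature.Barriers.ValiantsHypothesis

end
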